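import Summits.SmoothPoincare4.SmoothPoincare4.Theses.EntropyRung
import Summits.SmoothPoincare4.SmoothPoincare4.Theses.BachCriticalElement
import Summits.SmoothPoincare4.SmoothPoincare4.Theorems.EntropyRungSubcylindricalExistenceTransport

/-!
# Strategy census, round r1 (EXEMPT-46 re-exam) — the TYPED decompositions of
# crux stmt-SmoothPoincare4-10871 `EntropyRung.SubcylindricalExistence` (ENT)

Companion to `STRATEGY-CENSUS.md` §Decomposition (r1 table D0–D8). Everything is proved (no `sorry`,
no named fact, no new mathematical definition beyond Prop abbreviations). What is certified here:

* §1 **D0 — the summit's PSC split, imported.** `ENT ⇐ PscOnHomotopySpheres ∧ PscSpheresStandard`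
  where the two pieces are, BY NAME, the deciding cruxes of route BachCriticalElement
  (stmt-SmoothPoincare4-4395, stmt-SmoothPoincare4-4393; 4393 shared with SmallBranchSpheres; both with
  registered skeletons). Assembly `subcylindricalExistence_of_psc_of_pscStd` (non-trivial seam: the
  transported round witness `Theorems.subcylindricalClause_of_diffeomorph`). Formally (a)–(d)-clean
  (probes in `bc/D0D1_probes.lean`, all FAIL). NOT filed, because of `spc4_of_psc_of_pscStd`: with these
  two leaves in the cone the summit follows WITHOUT the route's rung (it is `BachCriticalElement.closes`
  verbatim) — filing D0 merges EntropyRung's existence side into BachCriticalElement and leaves the rung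
  eliminable from `closes`.
* §2 **D1 — the exact split along R > 0**, `ENT ↔ PscOnHomotopySpheres ∧ EntropyUpgrade` (now over
  the 4395 signature, so the PSC piece dedups with the shared item). Its entropy piece `EntropyUpgrade`
  is PSC-recognition in costume: `pscSpheresStandard_iff_upgrade_and_rung :
  PscSpheresStandard(4393) ↔ EntropyUpgrade ∧ SubcylindricalRecognition` (EXACT). Read positively this
  is the re-homing certificate: route EntropyRung is an ALTERNATIVE SPLIT of the shared node 4393 along
  Perelman entropy — "raise ν above ν_cyl keeping R > 0" (EntropyUpgrade) ∧ "recognise S⁴ above ν_cyl"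
  (the rung) — beside BachCriticalElement's E ∧ R split of the same node.
* §3 **D4 — curvature-free entropy existence** `HighEntropyExistence` (drop R > 0): typed; it still
  implies PSC-type positivity only through analysis not in the library, and is SPC4-implied
  (`highEntropyExistence_of_spc4`), so it is an [A]-class transfer statement (≡ SPC4 modulo a rung
  without the PSC clause); recorded, not filed.
[folklore]
-/

noncomputable section

set_option linter.dupNamespace false

open scoped Manifold ContDiff ContinuousMap
open MeasureTheory Set Literature.Geometry.Lorentzian
open Summit.SmoothPoincare4.SmoothPoincare4.Theses.EntropyRung
open Summit.SmoothPoincare4.SmoothPoincare4.Theses.BachCriticalElement (PscOnHomotopySpheres PscSpheresStandard)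

namespace Summit.SmoothPoincare4.SmoothPoincare4.Cruxes.SubcylindricalExistence.StrategyCensusR1

/-! ## §0 ENT's conclusion for one `M`, as an abbreviation (verbatim the `∃ g …` clause of the crux) -/

/-- The `∃ g …` clause of `SubcylindricalExistence` for one manifold `M` of its binder. -/
def EntConclusion (M : Type) [TopologicalSpace M] [T2Space M] [SecondCountableTopology M]
    [ChartedSpace (EuclideanSpace ℝ (Fin 4)) M] [IsManifold (𝓡 4) ∞ M] [CompactSpace M] [T3Space M]
    [MeasurableSpace M] [BorelSpace M] : Prop :=
  ∃ g : PseudoRiemannianMetric (𝓡 4) ∞ (EuclideanSpace ℝ (Fin 4)) (TangentSpace (𝓡 4) : M → Type _),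
    ∃ _ : g.HasLeviCivita, ∃ hg : g.IsRiemannian, (∀ x : M, 0 < g.scalarCurvature x) ∧
      ∃ δ : ℝ, 0 < δ ∧ ∀ τ : ℝ, 0 < τ → ∀ f : M → ℝ, ContMDiff (𝓡 4) 𝓘(ℝ, ℝ) ∞ f →
        ∫ x, (4 * Real.pi * τ) ^ (-(4 : ℝ) / 2) * Real.exp (-f x)
          ∂(riemannianMeasure (g.toContMDiffRiemannianMetric hg)) = 1 →
        Real.log 2 + Real.log Real.pi / 2 - 3 / 2 + δ ≤
          ∫ x, (τ * (g.scalarCurvature x + g.gradSq f x) + f x - 4) *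
            ((4 * Real.pi * τ) ^ (-(4 : ℝ) / 2) * Real.exp (-f x))
            ∂(riemannianMeasure (g.toContMDiffRiemannianMetric hg))

theorem subcylindricalExistence_iff_forall :
    SubcylindricalExistence ↔
      ∀ (M : Type) [TopologicalSpace M] [T2Space M] [SecondCountableTopology M]
        [ChartedSpace (EuclideanSpace ℝ (Fin 4)) M] [IsManifold (𝓡 4) ∞ M] [CompactSpace M] [T3Space M]
        [MeasurableSpace M] [BorelSpace M],
        M ≃ₕ Metric.sphere (0 : EuclideanSpace ℝ (Fin 5)) 1 → EntConclusion M :=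
  Iff.rfl

/-! ## §1 D0: `ENT ⇐ PscOnHomotopySpheres(4395) ∧ PscSpheresStandard(4393)` and why it is a merger -/

/-- **D0 assembly** (non-trivial seam): PSC-existence gives a PSC metric on `M`, PSC-recognition a
diffeomorphism `M ≃ₘ S⁴`, and the transported round witness (`subcylindricalClause_of_diffeomorph`,
p96669: `R = 12`, `ν = log 6 − 2 > ν_cyl`) gives ENT's conclusion. -/
theorem subcylindricalExistence_of_psc_of_pscStd (hP : PscOnHomotopySpheres) (hS : PscSpheresStandard) :
    SubcylindricalExistence := by
  intro M _ _ _ _ _ _ _ _ _ e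
  obtain ⟨Φ⟩ := hS M e (hP M e)
  exact Summit.SmoothPoincare4.SmoothPoincare4.Theorems.subcylindricalClause_of_diffeomorph Φ

/-- **Why D0 is not filed under EntropyRung: the rung becomes eliminable.** With D0's two leaves in
the cone, the summit follows WITHOUT `SubcylindricalRecognition` — this is route BachCriticalElement's
deciding theorem, verbatim. So D0 is not a redirect of THIS route's thesis but an import of another
route's deciding split. -/
theorem spc4_of_psc_of_pscStd (hP : PscOnHomotopySpheres) (hS : PscSpheresStandard) :
    _root_.SmoothPoincare4 :=
  Summit.SmoothPoincare4.SmoothPoincare4.Theses.BachCriticalElement.closes hP hS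

/-- … and conversely both D0 pieces are consequences of the summit (so neither is refutable short of
an exotic `S⁴`): PSC-existence through `subcylindricalExistence_of_spc4`, PSC-recognition trivially. -/
theorem d0_pieces_of_spc4 (h : _root_.SmoothPoincare4) : PscOnHomotopySpheres ∧ PscSpheresStandard := by
  refine ⟨fun M _ _ _ _ _ e ↦ ?_, fun M _ _ _ _ _ e _ ↦ ?_⟩
  · haveI : CompactSpace M :=
      Literature.Topology.FourManifolds.compactSpace_of_homotopyEquiv_sphere_four_holds M e
    letI : MeasurableSpace M := borel M
    haveI : BorelSpace M := ⟨rfl⟩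
    obtain ⟨g, hLC, hg, hR, -⟩ :=
      Summit.SmoothPoincare4.SmoothPoincare4.Theorems.subcylindricalExistence_of_spc4 h M e
    exact ⟨g, hLC, hg, hR⟩
  · exact h M ‹ChartedSpace (EuclideanSpace ℝ (Fin 4)) M› ‹IsManifold (𝓡 4) ∞ M› e

/-! ## §2 D1: the exact split along `R > 0`, and the re-homing certificate -/

/-- **Conditional entropy upgrade** (D1's entropy piece, over ENT's binders, PSC hypothesis in the
shape of item 4395): a homotopy 4-sphere carrying SOME PSC metric carries one with `ν > ν_cyl`. -/
def EntropyUpgrade : Prop :=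
  ∀ (M : Type) [TopologicalSpace M] [T2Space M] [SecondCountableTopology M]
    [ChartedSpace (EuclideanSpace ℝ (Fin 4)) M] [IsManifold (𝓡 4) ∞ M] [CompactSpace M] [T3Space M]
    [MeasurableSpace M] [BorelSpace M],
    M ≃ₕ Metric.sphere (0 : EuclideanSpace ℝ (Fin 5)) 1 →
    (∃ g : PseudoRiemannianMetric (𝓡 4) ∞ (EuclideanSpace ℝ (Fin 4)) (TangentSpace (𝓡 4) : M → Type _),
      ∃ _ : g.HasLeviCivita, g.IsRiemannian ∧ ∀ x, 0 < g.scalarCurvature x) →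
    EntConclusion M

/-- D1 glue (modus ponens per `M`; `trivial_seam`). -/
theorem subcylindricalExistence_of_psc_of_upgrade (hP : PscOnHomotopySpheres) (hU : EntropyUpgrade) :
    SubcylindricalExistence := by
  intro M _ _ _ _ _ _ _ _ _ e
  exact hU M e (hP M e)

/-- ENT contains PSC-existence in item 4395's exact shape (compactness of `M ≃ₕ S⁴` is the proved
tree theorem `compactSpace_of_homotopyEquiv_sphere_four_holds`; Borel structure chosen). -/
theorem psc_of_subcylindricalExistence (h : SubcylindricalExistence) : PscOnHomotopySpheres := by
  intro M _ _ _ _ _ e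
  haveI : CompactSpace M :=
    Literature.Topology.FourManifolds.compactSpace_of_homotopyEquiv_sphere_four_holds M e
  letI : MeasurableSpace M := borel M
  haveI : BorelSpace M := ⟨rfl⟩
  obtain ⟨g, hLC, hg, hR, -⟩ := h M e
  exact ⟨g, hLC, hg, hR⟩

theorem entropyUpgrade_of_subcylindricalExistence (h : SubcylindricalExistence) : EntropyUpgrade :=
  fun M _ _ _ _ _ _ _ _ _ e _ ↦ h M e

/-- **D1 is exact**: `ENT ↔ PscOnHomotopySpheres ∧ EntropyUpgrade`. -/
theorem subcylindricalExistence_iff_psc_and_upgrade :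
    SubcylindricalExistence ↔ PscOnHomotopySpheres ∧ EntropyUpgrade :=
  ⟨fun h ↦ ⟨psc_of_subcylindricalExistence h, entropyUpgrade_of_subcylindricalExistence h⟩,
    fun h ↦ subcylindricalExistence_of_psc_of_upgrade h.1 h.2⟩

/-- `PscSpheresStandard → EntropyUpgrade`, unconditionally (recognise, then transport). -/
theorem entropyUpgrade_of_pscStd (hS : PscSpheresStandard) : EntropyUpgrade := by
  intro M _ _ _ _ _ _ _ _ _ e hPSC
  obtain ⟨Φ⟩ := hS M e hPSC
  exact Summit.SmoothPoincare4.SmoothPoincare4.Theorems.subcylindricalClause_of_diffeomorph Φ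

/-- `PscSpheresStandard → SubcylindricalRecognition`: the rung is PSC-recognition restricted to the
sub-cylindrical regime (drop the entropy hypothesis). -/
theorem rung_of_pscStd (hS : PscSpheresStandard) : SubcylindricalRecognition := by
  intro M _ _ _ _ _ _ _ _ _ e g _ hg hR _
  exact hS M e ⟨g, ‹g.HasLeviCivita›, hg, hR⟩

/-- `EntropyUpgrade → SubcylindricalRecognition → PscSpheresStandard`: raise the entropy of the given
PSC metric, then recognise. (Item 4393's binder lacks `CompactSpace`/`T3`/Borel: discharged from
`M ≃ₕ S⁴` and `T2` exactly as in the route's `closes`.) -/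
theorem pscStd_of_upgrade_of_rung (hU : EntropyUpgrade) (hRung : SubcylindricalRecognition) :
    PscSpheresStandard := by
  intro M _ _ _ _ _ e hPSC
  haveI : CompactSpace M :=
    Literature.Topology.FourManifolds.compactSpace_of_homotopyEquiv_sphere_four_holds M e
  letI : MeasurableSpace M := borel M
  haveI : BorelSpace M := ⟨rfl⟩
  obtain ⟨g, hLC, hg, hR, hν⟩ := hU M e hPSC
  exact hRung M e g hg hR hν

/-- **Re-homing certificate (EXACT)**: `PscSpheresStandard ↔ EntropyUpgrade ∧ SubcylindricalRecognition`.
PSC-recognition on homotopy 4-spheres (the shared node stmt-SmoothPoincare4-4393 of routes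
BachCriticalElement / SmallBranchSpheres) splits along Perelman entropy into "raise ν above ν_cyl
keeping R > 0" and "recognise S⁴ above ν_cyl" — the latter is this route's rung. -/
theorem pscSpheresStandard_iff_upgrade_and_rung :
    PscSpheresStandard ↔ EntropyUpgrade ∧ SubcylindricalRecognition :=
  ⟨fun h ↦ ⟨entropyUpgrade_of_pscStd h, rung_of_pscStd h⟩, fun h ↦ pscStd_of_upgrade_of_rung h.1 h.2⟩

/-- Consequently D1's entropy piece is PSC-recognition modulo the rung (the (d)-failure of D1: any
plan for `EntropyUpgrade` is a plan for 4393). -/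
theorem entropyUpgrade_iff_pscStd (hRung : SubcylindricalRecognition) : EntropyUpgrade ↔ PscSpheresStandard :=
  ⟨fun hU ↦ pscStd_of_upgrade_of_rung hU hRung, entropyUpgrade_of_pscStd⟩

/-- The summit through D1's pieces and the rung — here the rung IS load-bearing (contrast `spc4_of_psc_of_pscStd`). -/
theorem spc4_of_psc_of_upgrade_of_rung (hP : PscOnHomotopySpheres) (hU : EntropyUpgrade)
    (hRung : SubcylindricalRecognition) : _root_.SmoothPoincare4 :=
  closes hRung (subcylindricalExistence_of_psc_of_upgrade hP hU)

/-! ## §3 D4: curvature-free entropy existence (drop `R > 0`) -/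

/-- **High-entropy existence without a curvature sign** (D4's piece H): every smooth homotopy 4-sphere
carries a Riemannian metric with `ν > ν_cyl`, no condition on `R`. Weaker than ENT formally; SPC4-implied. -/
def HighEntropyExistence : Prop :=
  ∀ (M : Type) [TopologicalSpace M] [T2Space M] [SecondCountableTopology M]
    [ChartedSpace (EuclideanSpace ℝ (Fin 4)) M] [IsManifold (𝓡 4) ∞ M] [CompactSpace M] [T3Space M]
    [MeasurableSpace M] [BorelSpace M],
    M ≃ₕ Metric.sphere (0 : EuclideanSpace ℝ (Fin 5)) 1 →
    ∃ g : PseudoRiemannianMetric (𝓡 4) ∞ (EuclideanSpace ℝ (Fin 4)) (TangentSpace (𝓡 4) : M → Type _),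
      ∃ _ : g.HasLeviCivita, ∃ hg : g.IsRiemannian,
        ∃ δ : ℝ, 0 < δ ∧ ∀ τ : ℝ, 0 < τ → ∀ f : M → ℝ, ContMDiff (𝓡 4) 𝓘(ℝ, ℝ) ∞ f →
          ∫ x, (4 * Real.pi * τ) ^ (-(4 : ℝ) / 2) * Real.exp (-f x)
            ∂(riemannianMeasure (g.toContMDiffRiemannianMetric hg)) = 1 →
          Real.log 2 + Real.log Real.pi / 2 - 3 / 2 + δ ≤
            ∫ x, (τ * (g.scalarCurvature x + g.gradSq f x) + f x - 4) *
              ((4 * Real.pi * τ) ^ (-(4 : ℝ) / 2) * Real.exp (-f x))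
              ∂(riemannianMeasure (g.toContMDiffRiemannianMetric hg))

theorem highEntropyExistence_of_subcylindricalExistence (h : SubcylindricalExistence) :
    HighEntropyExistence := by
  intro M _ _ _ _ _ _ _ _ _ e
  obtain ⟨g, hLC, hg, -, hν⟩ := h M e
  exact ⟨g, hLC, hg, hν⟩

/-- H is SPC4-implied (transport), hence — with any curvature-free rung — again `≡ SPC4`: class [A]. -/
theorem highEntropyExistence_of_spc4 (h : _root_.SmoothPoincare4) : HighEntropyExistence :=
  highEntropyExistence_of_subcylindricalExistence
    (Summit.SmoothPoincare4.SmoothPoincare4.Theorems.subcylindricalExistence_of_spc4 h)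

/-- D4's bridge piece, typed: "a metric with `ν > ν_cyl` can be replaced by a PSC metric with
`ν > ν_cyl`" (`ScalarUpgrade`). Open as analysis (λ(g) > 0 ⇒ Yamabe-positive ⇒ conformal PSC, but the
conformal change moves ν); if landed, H `≡` ENT `≡` SPC4 mod rung — the [A] pattern. -/
def ScalarUpgrade : Prop :=
  HighEntropyExistence → SubcylindricalExistence

theorem subcylindricalExistence_of_H_of_scalarUpgrade (hH : HighEntropyExistence) (hB : ScalarUpgrade) :
    SubcylindricalExistence :=
  hB hH

end Summit.SmoothPoincare4.SmoothPoincare4.Cruxes.SubcylindricalExistence.StrategyCensusR1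

end
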